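import Summits.HodgeConjecture.HodgeCM.PerL34.GenuineTensorModel_1

/-! PORT of `HodgeCM/PerL34/GenuineTensorModel.lean` (HodgeCMPerL run 81) — part 2: continuation of `Summits.HodgeConjecture.HodgeCM.PerL34.GenuineTensorModel_1` (split at a top-level declaration boundary by port_pkg.py; scope re-opened below; declarations unchanged). -/

-- port_pkg: scope re-opened for this part (file-level context, then the namespace/section stack open at the cut)
set_option autoImplicit false
noncomputable section
open MeasureTheory MeasureTheory.Measure Set Metric Function Complex ComplexConjugate Topology Filter
open scoped RestrictedProduct InnerProductSpace NNReal ENNReal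
namespace HodgeCM.PerL34.RestrictedTensor
open HodgeCM.PerL34.LocalFactors HodgeCM.PerL34.LocalFactors.DilationModel
namespace Genuine
open NumberField IsDedekindDomain HodgeCM.PerL34.IdelePlaces HodgeCM.PerL34.NoSmallSubgroups
open HodgeCM.PerL34.IdelicTorusModel HodgeCM.PerL34.IdelicTorusModel.Genuine HodgeCM.PerL34.PureTensor
attribute [local instance] LocalFactors.DilationModel.Adic.nontriviallyNormedField
  LocalFactors.DilationModel.Adic.properSpace
variable (L : Type) [Field L] [NumberField L]
  [∀ v : HeightOneSpectrum (𝓞 (maximalRealSubfield L)), MeasurableSpace (v.adicCompletion (maximalRealSubfield L))]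
  [∀ v : HeightOneSpectrum (𝓞 (maximalRealSubfield L)), BorelSpace (v.adicCompletion (maximalRealSubfield L))]
variable [IsCMField L] [DecidableEq (Place (maximalRealSubfield L))] (χ : Model L →* Circle)
  (ν : ∀ i : Place (maximalRealSubfield L), ((basePlaceOf L i).adicCompletion (maximalRealSubfield L))ˣ →* Circle)
variable (S : Finset (Place (maximalRealSubfield L)))
  (x₀ : ∀ i : Place (maximalRealSubfield L), Fin 3 → (basePlaceOf L i).adicCompletion (maximalRealSubfield L))
  (r : Place (maximalRealSubfield L) → ℝ)
/-- **the distinguished vector** `φ• := ⊗_i φ•_i ∈ ⊗′_i H_i` (an `abbrev`: unification sees `tp`). -/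
abbrev phi : Space (unitFam L) := tp (unitFam L) (phiFam L S x₀ r)

variable {r} in
/-- `(hφ)`  `‖φ•‖ = 1`. -/
theorem norm_phi (hr0 : ∀ i ∈ S, IsSplitPlace L i → 0 < r i) : ‖phi L S x₀ r‖ = 1 :=
  norm_tp_eq_one _ (norm_phiFam L S x₀ hr0)

/-! ### The END-shape statements `(hK)`, `(hM)`, `(hloc)` for `ω := ⊗′ ρ_i`, `φ := φ•` -/

section statements

variable {χ ν} {T' : Finset (Place (maximalRealSubfield L))}
  (hν : ∀ i, i ∉ S → IsSplitPlace L i → ∀ u : ((basePlaceOf L i).adicCompletion (maximalRealSubfield L))ˣ,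
    ‖(u : (basePlaceOf L i).adicCompletion (maximalRealSubfield L))‖ = 1 → ν i u = 1)
  (hχT' : RestrictedProduct.boxSubgroup (genLevel L) T' ≤ χ.ker)

/-- `(hK)`  **the level**: the box subgroup `K_{S ∪ T'}` fixes `φ•`. -/
theorem rep_phi_eq_self {k : Model L} (hk : k ∈ RestrictedProduct.boxSubgroup (genLevel L) (S ∪ T')) :
    rep (admissible L hν hχT') k (phi L S x₀ r) = phi L S x₀ r :=
  rep_tp_eq_self_of_mem_boxSubgroup (admissible L hν hχT') (phiFam L S x₀ r) (fun i hi b hb => by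
    rw [phiFam_apply_of_not L S x₀ r i (fun h => hi (Finset.mem_union_left _ h.1))]
    exact locRep_e L hν hχT' (fun h => hi (Finset.mem_union_left _ h))
      (fun h => hi (Finset.mem_union_right _ h)) hb) hk

variable {r} in
/-- `(hM)`  **multiplicativity of the matrix coefficient on EVERY finite set of places** (no `T ⊆ S₁` needed):
`⟨φ•, ω(y) φ•⟩ = ∏_{i ∈ S₁} c_i(y_i)`. -/
theorem inner_phi_rep_extendOne (hr0 : ∀ i ∈ S, IsSplitPlace L i → 0 < r i)
    (S₁ : Finset (Place (maximalRealSubfield L))) (y : (i : ↥S₁) → locTorus (maximalRealSubfield L) L i) :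
    inner ℂ (phi L S x₀ r) (rep (admissible L hν hχT') (PureTensor.extendOne (genLevel L) S₁ y) (phi L S x₀ r)) =
      ∏ i : ↥S₁, PureTensor.localCoeff (genLevel L) (rep (admissible L hν hχT')) (phi L S x₀ r) i (y i) :=
  inner_tp_rep_extendOne_tp_eq_prod_localCoeff (admissible L hν hχT') (phiFam L S x₀ r) (norm_phiFam L S x₀ hr0) S₁ y

include hχT' in
/-- local strong continuity of every `ρ_i`. -/
theorem continuous_locRep_apply (hνc : ∀ i, IsSplitPlace L i → Continuous (ν i))
    (hlocχ : ∀ i ∈ T', Continuous fun g : locTorus (maximalRealSubfield L) L i =>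
      χ (RestrictedProduct.mulSingle (genLevel L) i g))
    (i : Place (maximalRealSubfield L)) (w : LocH L i) :
    Continuous fun g : locTorus (maximalRealSubfield L) L i => locRep L χ ν i g w := by
  by_cases hs : IsSplitPlace L i
  · simp_rw [locRep_apply_of_isSplitPlace L χ ν i hs]
    exact (continuous_dilationRep_apply _ (ν i) (hνc i hs) w).comp (baseTriv L i hs).continuous
  · simp_rw [locRep_apply_of_not_isSplitPlace L χ ν i hs]
    by_cases hiT : i ∈ T'
    · exact (Complex.continuous_conj.comp (continuous_subtype_val.comp (hlocχ i hiT))).smul continuous_const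
    · have h1 : ∀ g : locTorus (maximalRealSubfield L) L i,
          χ (RestrictedProduct.mulSingle (genLevel L) i g) = 1 := fun g =>
        chi_mulSingle_eq_one L hχT' hiT (by rw [genLevel_eq_top_of_not_isSplitPlace L i hs]; exact Subgroup.mem_top g)
      simp_rw [h1, Circle.coe_one, map_one, one_smul]
      exact continuous_const

/-- `(hloc)`  **strong continuity of `g ↦ ω(ι_i g) v` for EVERY `i` and EVERY `v ∈ ⊗′ H_i`.** -/
theorem continuous_rep_mulSingle_apply (hνc : ∀ i, IsSplitPlace L i → Continuous (ν i))
    (hlocχ : ∀ i ∈ T', Continuous fun g : locTorus (maximalRealSubfield L) L i =>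
      χ (RestrictedProduct.mulSingle (genLevel L) i g))
    (i : Place (maximalRealSubfield L)) (v : Space (unitFam L)) :
    Continuous fun g : locTorus (maximalRealSubfield L) L i =>
      rep (admissible L hν hχT') (RestrictedProduct.mulSingle (genLevel L) i g) v :=
  continuous_rep_mulSingle (admissible L hν hχT') i (continuous_locRep_apply L hχT' hνc hlocχ i) v

/-! ### THE INHABITANT of `GenuineThetaInput` -/

variable {r} in
/-- **The restricted tensor product model inhabits `GenuineThetaInput L S (⊗′H) (⊗′ρ) φ• χ`** — for every CM field
`L`, every finite set of places `S` of `L⁺`, every global character `χ` of level `K_{T'}`, every family of local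
characters `ν_i` unramified off `S`, every choice of centres `x₀_i ≠ 0`-balls `B(x₀_i, r_i)` (`0 < r_i < |x₀_i|`)
on which `ν_i` and `χ_i` are trivial at the split places of `S`.  The intertwiners are the slot isometries of `⊗′`;
`hiso` holds by construction (scalar local factor `conj χ_i`). -/
def thetaInput (hr : ∀ i ∈ S, IsSplitPlace L i → r i < ‖x₀ i‖) (hr0 : ∀ i ∈ S, IsSplitPlace L i → 0 < r i)
    (hνS : ∀ i ∈ S, IsSplitPlace L i → ∀ y : ((basePlaceOf L i).adicCompletion (maximalRealSubfield L))ˣ,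
      (y : (basePlaceOf L i).adicCompletion (maximalRealSubfield L)) ∈ U1 (x₀ i) (r i) → ν i y = 1)
    (hχS : ∀ i (_ : i ∈ S) (hs : IsSplitPlace L i), ∀ g : locTorus (maximalRealSubfield L) L i,
      ((baseTriv L i hs g : ((basePlaceOf L i).adicCompletion (maximalRealSubfield L))ˣ) :
          (basePlaceOf L i).adicCompletion (maximalRealSubfield L)) ∈ U1 (x₀ i) (r i) →
        χ (RestrictedProduct.mulSingle (genLevel L) i g) = 1) :
    GenuineThetaInput L S (Space (unitFam L)) (rep (admissible L hν hχT')) (phi L S x₀ r) χ where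
  ν := ν
  hν := hν
  VU i _ _ := slot (unitFam L) (phiFam L S x₀ r) (norm_phiFam L S x₀ hr0) i
  hVUψ i hi hs := by
    rw [← unitFam_e, ← phiFam_apply_of_not L S x₀ r i (fun h => hi h.1)]
    exact slot_apply_self _ _ i
  hVU i hi hs g := by
    rw [rep_mulSingle_slot, locRep_apply_of_isSplitPlace L χ ν i hs]
  x₀ := x₀
  r := r
  a := ballA L x₀ r
  hr := hr
  hr0 := hr0
  hνS := hνS
  hχS := hχS
  VS i _ _ := slot (unitFam L) (phiFam L S x₀ r) (norm_phiFam L S x₀ hr0) i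
  hVSψ i hi hs := by
    rw [← phiFam_apply_of_mem L S x₀ r i hi hs]
    exact slot_apply_self _ _ i
  hVS i hi hs g := by
    rw [rep_mulSingle_slot, locRep_apply_of_isSplitPlace L χ ν i hs]
  hiso i _ hns g :=
    rep_mulSingle_tp_of_smul (admissible L hν hχT') (phiFam L S x₀ r) i g _
      (locRep_apply_of_not_isSplitPlace L χ ν i hns g (phiFam L S x₀ r i))

end statements

/-! ### Smoke test: the UNCONDITIONAL inhabitant (trivial characters, centre `x₀ = (1,1,1)`, radius `1/2`) -/

section smoke

omit [∀ v : HeightOneSpectrum (𝓞 (maximalRealSubfield L)), MeasurableSpace (v.adicCompletion (maximalRealSubfield L))]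
  [∀ v : HeightOneSpectrum (𝓞 (maximalRealSubfield L)), BorelSpace (v.adicCompletion (maximalRealSubfield L))]
  [DecidableEq (Place (maximalRealSubfield L))] in
/-- (Ported verbatim from the HodgeCMPerL package; no docstring in the source.) -/
theorem one_unram (S : Finset (Place (maximalRealSubfield L))) :
    ∀ i, i ∉ S → IsSplitPlace L i → ∀ u : ((basePlaceOf L i).adicCompletion (maximalRealSubfield L))ˣ,
      ‖(u : (basePlaceOf L i).adicCompletion (maximalRealSubfield L))‖ = 1 →
        (fun j : Place (maximalRealSubfield L) =>
          (1 : ((basePlaceOf L j).adicCompletion (maximalRealSubfield L))ˣ →* Circle)) i u = 1 :=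
  fun _ _ _ _ _ => rfl

omit [∀ v : HeightOneSpectrum (𝓞 (maximalRealSubfield L)), MeasurableSpace (v.adicCompletion (maximalRealSubfield L))]
  [∀ v : HeightOneSpectrum (𝓞 (maximalRealSubfield L)), BorelSpace (v.adicCompletion (maximalRealSubfield L))]
  [IsCMField L] [DecidableEq (Place (maximalRealSubfield L))] in
/-- (Ported verbatim from the HodgeCMPerL package; no docstring in the source.) -/
theorem boxSubgroup_le_ker_one :
    RestrictedProduct.boxSubgroup (genLevel L) (∅ : Finset (Place (maximalRealSubfield L))) ≤
      (1 : Model L →* Circle).ker := by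
  rw [MonoidHom.ker_one]; exact le_top

/-- the smoke-test representation `ω₁ := ⊗′_i ρ_i` with all `ν_i = 1`, `χ = 1`. -/
abbrev omegaOne (S : Finset (Place (maximalRealSubfield L))) :
    Model L →* (Space (unitFam L) ≃ₗᵢ[ℂ] Space (unitFam L)) :=
  rep (admissible L (S := S) (one_unram L S) (boxSubgroup_le_ker_one L))

/-- the smoke-test vector: centres `x₀_i = (1,1,1)`, radii `1/2` at the split places of `S`. -/
abbrev phiOne (S : Finset (Place (maximalRealSubfield L))) : Space (unitFam L) :=
  phi L S (fun _ _ => 1) (fun _ => 1 / 2)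

/-- **`GenuineThetaInput` is inhabited, unconditionally, for every CM field `L` and every finite `S`.** -/
def smokeInput (S : Finset (Place (maximalRealSubfield L))) :
    GenuineThetaInput L S (Space (unitFam L)) (omegaOne L S) (phiOne L S) 1 :=
  thetaInput L S (fun _ _ => 1) (one_unram L S) (boxSubgroup_le_ker_one L)
    (fun i _ _ => by rw [pi_norm_const, norm_one]; norm_num) (fun _ _ _ => one_half_pos) (fun _ _ _ _ _ => rfl)
    (fun _ _ _ _ _ => rfl)

/-- **Smoke test (all four `(ω, φ)`-hypotheses of the S3 END + the input structure, no hypotheses left):**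
`‖φ₁‖ = 1`, `K_S` fixes `φ₁`, the matrix coefficient is multiplicative on every finite set of places, every
`g ↦ ω₁(ι_i g) v` is continuous, and `GenuineThetaInput L S (⊗′H) ω₁ φ₁ 1` is inhabited. -/
theorem smoke (S : Finset (Place (maximalRealSubfield L))) :
    ‖phiOne L S‖ = 1 ∧
    (∀ k ∈ RestrictedProduct.boxSubgroup (genLevel L) (S ∪ ∅), omegaOne L S k (phiOne L S) = phiOne L S) ∧
    (∀ (S₁ : Finset (Place (maximalRealSubfield L))) (y : (i : ↥S₁) → locTorus (maximalRealSubfield L) L i),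
      inner ℂ (phiOne L S) (omegaOne L S (PureTensor.extendOne (genLevel L) S₁ y) (phiOne L S)) =
        ∏ i : ↥S₁, PureTensor.localCoeff (genLevel L) (omegaOne L S) (phiOne L S) i (y i)) ∧
    (∀ (i : Place (maximalRealSubfield L)) (v : Space (unitFam L)),
      Continuous fun g : locTorus (maximalRealSubfield L) L i =>
        omegaOne L S (RestrictedProduct.mulSingle (genLevel L) i g) v) ∧
    Nonempty (GenuineThetaInput L S (Space (unitFam L)) (omegaOne L S) (phiOne L S) 1) :=
  ⟨norm_phi L S _ fun _ _ _ => one_half_pos,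
    fun _ hk => rep_phi_eq_self L S _ _ (one_unram L S) (boxSubgroup_le_ker_one L) hk,
    fun S₁ y => inner_phi_rep_extendOne L S _ (one_unram L S) (boxSubgroup_le_ker_one L)
      (fun _ _ _ => one_half_pos) S₁ y,
    fun i v => continuous_rep_mulSingle_apply L S (one_unram L S) (boxSubgroup_le_ker_one L)
      (fun _ _ => continuous_const) (fun _ h => (Finset.notMem_empty _ h).elim) i v,
    ⟨smokeInput L S⟩⟩

end smoke

end Genuine

end HodgeCM.PerL34.RestrictedTensor

-- port_pkg: scope closed for this part
end
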